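import Summits.ValiantsHypothesis.ValiantsHypothesis.Theorems.DivisionGapSquareGridDimersDivisionEasyCircuits
import Summits.ValiantsHypothesis.ValiantsHypothesis.Theses.DivisionGap

/-!
# `SquareGridDimersDivisionEasy`: the item unbundled, degenerate sizes, and the witness `h`

`item_iff` unbundles the route decl definitionally (`sqPoly N` is the item's `D_N`); for odd `N`,
`D_N = 0` (a fixed-point-free involution needs an even number of vertices) and `D_0 = 1`.  For
`N = 2k+2`: the positivity structure `SN` (`ℝ≥0`-polynomials inside the fraction field of the real
polynomials), the initial valuation `s0` of Propp's algorithm on the Aztec diamond of order `2k+1`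
carrying the grid, the numerator/denominator polynomials `Num`, `Den`, the witness
`hP = (#corner matchings) · Den`, the identity `Num = D_N · hP` with `hP ≠ 0`
(`num_eq_and_hP_ne_zero`), and the circuit bounds of `Num`, `Den`. [cite: Propp2003, §2]

All `def … : Prop` declarations in this file are decidable predicates on finite data (not named facts).
Support file for `SquareGridDimersDivisionEasy` (route DivisionGap, item stmt-ValiantsHypothesis-5072);
the closing theorem is `squareGridDimersDivisionEasy_proof` in `…DivisionGapSquareGridDimersDivisionEasy.lean`.
-/

namespace Summit.ValiantsHypothesis.ValiantsHypothesis.Theorems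

namespace SquareGridDimers

set_option linter.dupNamespace false

noncomputable section

open Finset

/-! ## The item: unbundling, degenerate sizes, and the even case -/

section Final

open Literature.Computability.AlgebraicComplexity
open scoped NNReal

/-- The item's dimer predicate on `Fin N × Fin N`, verbatim. [folklore] -/
def IsSqDimer {N : ℕ} (f : Fin N × Fin N → Fin N × Fin N) : Prop := ∀ v, f (f v) = v ∧ f v ≠ v ∧ Adj4 v (f v)

/-- Decidability of the dimer predicate. [folklore] -/
instance {N : ℕ} (f : Fin N × Fin N → Fin N × Fin N) : Decidable (IsSqDimer f) := by
  unfold IsSqDimer; infer_instance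

/-- The item's set of dimer covers of the `N × N` grid. [folklore] -/
def sqDimers (N : ℕ) : Finset (Fin N × Fin N → Fin N × Fin N) := univ.filter IsSqDimer

/-- The item's polynomial `D_N = Σ_f Π_v x_(v, f v)` (domino tilings of the `N × N` square, doubled
edge variables). [folklore] -/
def sqPoly (N : ℕ) : MvPolynomial ((Fin N × Fin N) × (Fin N × Fin N)) ℝ≥0 :=
  ∑ f ∈ sqDimers N, ∏ v : Fin N × Fin N, MvPolynomial.X (v, f v)

/-- The item, unbundled (definitional). -/
theorem item_iff : Theses.DivisionGap.SquareGridDimersDivisionEasy ↔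
    ∃ c : ℕ, ∀ n : ℕ, ∃ h : MvPolynomial ((Fin n × Fin n) × (Fin n × Fin n)) ℝ≥0,
      h ≠ 0 ∧ complexity (sqPoly n * h) + complexity h ≤ n ^ c + c :=
  Iff.rfl

/-- A dimer cover is a fixed-point-free involution, so `N` is even (`N²` is). [folklore] -/
theorem even_of_mem_sqDimers {N : ℕ} {f : Fin N × Fin N → Fin N × Fin N} (hf : f ∈ sqDimers N) :
    Even N := by
  classical
  rw [sqDimers, mem_filter] at hf
  have hd := hf.2
  have hinv : Function.Involutive f := fun v => (hd v).1
  set τ : Equiv.Perm (Fin N × Fin N) := hinv.toPerm f with hτ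
  have hτ2 : τ ^ 2 ^ 1 = 1 := by
    rw [pow_one, sq]
    refine Equiv.ext fun v => ?_
    simp [τ, Equiv.Perm.mul_apply, hinv v]
  by_contra hodd
  have hcard : ¬ 2 ∣ Fintype.card (Fin N × Fin N) := by
    rw [Fintype.card_prod, Fintype.card_fin]
    intro h2
    exact hodd ((Nat.even_mul.1 (even_iff_two_dvd.2 h2)).elim id id)
  haveI : Fact (Nat.Prime 2) := ⟨Nat.prime_two⟩
  obtain ⟨a, ha⟩ := Equiv.Perm.exists_fixed_point_of_prime hcard hτ2
  exact (hd a).2.1 (by simpa [τ] using ha)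

/-- For odd `N` the item's polynomial vanishes. [folklore] -/
theorem sqPoly_eq_zero_of_odd {N : ℕ} (hN : Odd N) : sqPoly N = 0 := by
  have h : sqDimers N = ∅ := by
    ext f
    simp only [Finset.notMem_empty, iff_false]
    intro hf
    exact (Nat.not_even_iff_odd.2 hN) (even_of_mem_sqDimers hf)
  rw [sqPoly, h, sum_empty]

/-- For `N = 0` the item's polynomial is `1` (the empty cover). [folklore] -/
theorem sqPoly_zero : sqPoly 0 = 1 := by
  have h1 : ∀ f : Fin 0 × Fin 0 → Fin 0 × Fin 0,
      (∏ v : Fin 0 × Fin 0, (MvPolynomial.X (v, f v) : MvPolynomial ((Fin 0 × Fin 0) × (Fin 0 × Fin 0)) ℝ≥0)) = 1 :=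
    fun f => Fintype.prod_empty _
  have h2 : sqDimers 0 = univ := by
    ext f
    simp only [sqDimers, mem_filter, mem_univ, true_and, iff_true]
    intro v; exact v.1.elim0
  simp only [sqPoly, h1, h2, sum_const, card_univ, nsmul_eq_mul, mul_one]
  norm_num [Fintype.card_fun]

/-! ### The even case `N = 2k + 2` -/

variable (kk : ℕ)

/-- The item's variables for `N = 2k+2`. [folklore] -/
abbrev σN : Type := GV kk × GV kk

/-- The item's coefficient semiring of polynomials. [folklore] -/
abbrev PN : Type := MvPolynomial (σN kk) ℝ≥0

/-- The real polynomials. [folklore] -/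
abbrev PR : Type := MvPolynomial (σN kk) ℝ

/-- The field of real rational functions. [folklore] -/
abbrev Fq : Type := FractionRing (PR kk)

/-- The pair weights of the item: `x u v = X_(u, v)`. [folklore] -/
def xX (u v : GV kk) : PN kk := MvPolynomial.X (u, v)

/-- The item's polynomial at `N = 2k+2` is the involution sum `sqSum`. [folklore] -/
theorem sqPoly_eq_sqSum : sqPoly (2 * kk + 2) = sqSum (xX kk) := by
  unfold sqPoly sqSum sqDimers xX
  refine sum_congr ?_ fun f _ => rfl
  exact filter_congr fun f _ => Iff.rfl

/-- The embedding of `ℝ≥0`-polynomials into real rational functions. [folklore] -/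
def embN : PN kk →+* Fq kk := (algebraMap (PR kk) (Fq kk)).comp (MvPolynomial.map NNReal.toRealHom)

/-- The embedding is injective. [folklore] -/
theorem embN_injective : Function.Injective (embN kk) :=
  (IsFractionRing.injective (PR kk) (Fq kk)).comp
    (MvPolynomial.map_injective NNReal.toRealHom NNReal.coe_injective)

/-- The positivity structure of the item: `ℝ≥0`-polynomials inside real rational functions. [folklore] -/
def SN : PosSys (PN kk) (Fq kk) where
  emb := embN kk
  inj := embN_injective kk
  eq_zero_of_add_eq_zero a b h := by
    refine MvPolynomial.ext _ _ fun d => ?_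
    have hc : MvPolynomial.coeff d a + MvPolynomial.coeff d b = (0 : ℝ≥0) := by
      simpa using congrArg (MvPolynomial.coeff d) h
    rw [MvPolynomial.coeff_zero]
    exact (add_eq_zero.mp hc).1
  eq_zero_or_eq_zero_of_mul_eq_zero a b h := by
    have hi : Function.Injective (MvPolynomial.map (σ := σN kk) NNReal.toRealHom) :=
      MvPolynomial.map_injective NNReal.toRealHom NNReal.coe_injective
    have : MvPolynomial.map NNReal.toRealHom a * MvPolynomial.map NNReal.toRealHom b = 0 := by
      rw [← map_mul, h, map_zero]
    rcases mul_eq_zero.mp this with h0 | h0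
    · left; exact hi (by rw [h0, map_zero])
    · right; exact hi (by rw [h0, map_zero])
  one_ne_zero' := one_ne_zero

/-- The initial valuation of the level-`n` variables (`n = 2k+1`): numerators are the square-grid
weights, denominators and accumulators are `1`. [folklore] -/
def s0 : VarL (2 * kk + 1) → PN kk
  | Sum.inl (e, true) => ew0 (xX kk) e
  | Sum.inl (_, false) => 1
  | Sum.inr _ => 1

/-- The numerator polynomial `g = D · h`. [folklore] -/
def Num : PN kk := MvPolynomial.aeval (s0 kk) (Φ ℝ≥0 (2 * kk + 1) true)

/-- The denominator polynomial. [folklore] -/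
def Den : PN kk := MvPolynomial.aeval (s0 kk) (Φ ℝ≥0 (2 * kk + 1) false)

/-- The item's witness `h`: the number of perfect matchings of the corner regions times the
denominator polynomial. [folklore] -/
def hP : PN kk := ((pmSet (G kk)ᶜ).card : PN kk) * Den kk

/-- Crossing in absolute coordinates is crossing the grid boundary. [folklore] -/
theorem inDia_absH_iff (e : E (2 * kk + 1)) :
    InDia (2 * kk + 1) (absH (2 * kk + 1) (emb e)) ↔ InRange kk (gH kk e) := by
  have := e.2.1.isLt
  simp only [InDia, absH, emb, InRange, gH]
  push_cast
  omega

/-- Crossing in absolute coordinates is crossing the grid boundary. [folklore] -/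
theorem inDia_absV_iff (e : E (2 * kk + 1)) :
    InDia (2 * kk + 1) (absV (2 * kk + 1) (emb e)) ↔ InRange kk (gV kk e) := by
  have := e.2.2.isLt
  simp only [InDia, absV, emb, InRange, gV]
  push_cast
  omega

/-- The initial valuation satisfies the positivity invariant. [folklore] -/
theorem invS_s0 : InvS (SN kk) (2 * kk + 1) (2 * kk + 1) (fun v => (SN kk).emb (s0 kk v)) := by
  refine ⟨fun e => ?_, fun e => ?_, ?_, ?_⟩
  · have hx : Xing (2 * kk + 1) (2 * kk + 1) (emb e) ↔ ¬ (InRange kk (gH kk e) ↔ InRange kk (gV kk e)) := by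
      unfold Xing; rw [inDia_absH_iff, inDia_absV_iff]
    simp only [s0, hx]
    unfold ew0
    constructor
    · intro h
      rw [if_neg (fun hh => h ⟨fun _ => hh.2, fun _ => hh.1⟩),
        if_neg (fun hh => h ⟨fun a => absurd a hh.1, fun b => absurd b hh.2⟩), map_zero]
    · intro h
      rw [not_not] at h
      by_cases h1 : InRange kk (gH kk e)
      · rw [if_pos ⟨h1, h.mp h1⟩]
        exact (SN kk).isPos_emb ((SN kk).mul_ne_zero_of (MvPolynomial.X_ne_zero _) (MvPolynomial.X_ne_zero _))
      · rw [if_neg (fun hh => h1 hh.1), if_pos ⟨h1, fun h2 => h1 (h.mpr h2)⟩]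
        exact (SN kk).isPos_emb one_ne_zero
  · simp only [s0, map_one]; exact (SN kk).isPos_one
  · simp only [s0, map_one]; exact (SN kk).isPos_one
  · simp only [s0, map_one]; exact (SN kk).isPos_one

/-- Ring homomorphisms commute with the dimer partition function. [folklore] -/
theorem map_Z {m : ℕ} {R R' : Type*} [CommSemiring R] [CommSemiring R'] (g : R →+* R') (U : Finset (V m))
    (ew : E m → R) : g (Z U ew) = Z U (fun e => g (ew e)) := by
  unfold Z
  rw [map_sum]
  exact sum_congr rfl fun M _ => map_prod g _ _

/-- **The polynomial identity** `g = D · h` and the nonvanishing of `h`. [cite: Propp2003, §2] -/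
theorem num_eq_and_hP_ne_zero : Num kk = sqSum (xX kk) * hP kk ∧ hP kk ≠ 0 := by
  have hinv : InvS (SN kk) (2 * kk + 1) (2 * kk + 1) (fun v => (SN kk).emb (s0 kk v)) := invS_s0 kk
  have hgood : Good ((SN kk).emb.comp (algebraMap ℝ≥0 (PN kk))) (2 * kk + 1)
      (fun v => (SN kk).emb (s0 kk v)) := good_of_invS _ _ le_rfl hinv
  obtain ⟨hF0, hratio⟩ := eval_Φ ((SN kk).emb.comp (algebraMap ℝ≥0 (PN kk))) (2 * kk + 1) _ hgood
  have hT := isPos_eval_Φ (φ := (SN kk).emb.comp (algebraMap ℝ≥0 (PN kk))) (2 * kk + 1)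
    (fun v => (SN kk).emb (s0 kk v)) true le_rfl hinv
  have hA : ∀ b, (SN kk).emb (MvPolynomial.aeval (s0 kk) (Φ ℝ≥0 (2 * kk + 1) b)) =
      MvPolynomial.eval₂Hom ((SN kk).emb.comp (algebraMap ℝ≥0 (PN kk)))
        (fun v => (SN kk).emb (s0 kk v)) (Φ ℝ≥0 (2 * kk + 1) b) :=
    fun b => MvPolynomial.map_aeval _ _ _
  have hWs : Ws (fun v => (SN kk).emb (s0 kk v)) = fun e => (SN kk).emb (ew0 (xX kk) e) := by
    funext e; simp [Ws, s0]
  have hacc : (fun v => (SN kk).emb (s0 kk v)) (Sum.inr true) /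
      (fun v => (SN kk).emb (s0 kk v)) (Sum.inr false) = 1 := by simp [s0]
  rw [hacc, one_mul, hWs, ← map_Z, Z_univ_ew0, ← hA true, ← hA false] at hratio
  rw [← hA false] at hF0
  rw [← hA true] at hT
  -- hratio : emb Num' / emb Den' = emb (sqSum * card)
  have hNum : (SN kk).emb (Num kk) = (SN kk).emb (sqSum (xX kk) * hP kk) := by
    unfold hP
    rw [← mul_assoc, map_mul, ← hratio]
    unfold Num Den
    field_simp
  refine ⟨(SN kk).inj hNum, ?_⟩
  intro h0
  have h1 : (SN kk).emb (hP kk) = 0 := by rw [h0, map_zero]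
  unfold hP at h1
  rw [map_mul] at h1
  rcases mul_eq_zero.mp h1 with h2 | h2
  · have h3 : (SN kk).emb (sqSum (xX kk) * ((pmSet (G kk)ᶜ).card : PN kk)) = 0 := by
      rw [map_mul, h2, mul_zero]
    rw [← hratio] at h3
    exact (div_ne_zero hT.ne_zero hF0) h3
  · exact hF0 h2

/-- Cost of the initial valuation: one gate per numerator, none elsewhere. [folklore] -/
theorem complexity_s0_le (v : VarL (2 * kk + 1)) : complexity (s0 kk v) ≤ 1 := by
  have h1 : complexity (1 : PN kk) ≤ 1 := by
    have : complexity (1 : PN kk) = 0 := by simpa using complexity_C_holds (σ := σN kk) (1 : ℝ≥0)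
    omega
  rcases v with ⟨e, _ | _⟩ | b
  · exact h1
  · simp only [s0]
    unfold ew0
    split_ifs
    · calc _ ≤ complexity (xX kk (toGV kk (gH kk e)) (toGV kk (gV kk e))) +
            complexity (xX kk (toGV kk (gV kk e)) (toGV kk (gH kk e))) + 1 := complexity_mul_le_holds _ _
        _ = 1 := by rw [xX, xX, complexity_X_holds, complexity_X_holds]
    · exact h1
    · have : complexity (0 : PN kk) = 0 := by simpa using complexity_C_holds (σ := σN kk) (0 : ℝ≥0)
      omega
  · exact h1

/-- Circuit size of the substituted layered polynomials. [folklore] -/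
theorem complexity_aeval_s0_le (b : Bool) :
    complexity (MvPolynomial.aeval (s0 kk) (Φ ℝ≥0 (2 * kk + 1) b)) ≤ 62 * (2 * kk + 1) ^ 3 + 8 * (2 * kk + 1) ^ 2 + 2 := by
  calc _ ≤ complexity (Φ ℝ≥0 (2 * kk + 1) b) + ∑ v, complexity (s0 kk v) := complexity_aeval_le _ _
    _ ≤ 62 * (2 * kk + 1) ^ 3 + ∑ _v : VarL (2 * kk + 1), 1 := by
        gcongr with v
        · exact complexity_Φ_le ℝ≥0 _ b
        · exact complexity_s0_le kk v
    _ = 62 * (2 * kk + 1) ^ 3 + 8 * (2 * kk + 1) ^ 2 + 2 := by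
        simp [Finset.card_univ]; ring

end Final

end

end SquareGridDimers

end Summit.ValiantsHypothesis.ValiantsHypothesis.Theorems
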